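import Summits.ResolutionOfSingularities.ResolutionOfSingularities.Theorems.PurelyInseparableDim4FreeTailConsequences
import HarnessLib
import HarnessLib.Audit.Tags

/-!
# Purely inseparable four-folds — LAYERS in the isolated band, every prime: the two-layer shape lemma
# SH(q), idea-4's triple bound, and the UPPER-BAND half of K2(p) from the free-tail lemma

[OURS · counted 0 · cell `res-dim4-pi` · F4-I(p,p) band half (K2(p)) · seat res-dim4-p-12 g2.]
Nothing here proves `NoIsolatedTrap p p` or resolution of singularities in dimension ≥ 4 / characteristic `p`.

The tree proves K2(3) (`FreeTailProof.noIsolatedBandRun3`, p660329) from the free-tail lemma FT(3,3)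
(`FreeTailProof.noIsolatedFreeTailAt_self`, every `p`) and the SHAPE LEMMA (SH3) of card I-7-2
(`FreeTail.shapeLemma3`, p-9): two order-`4` states and a satellite step hand `c (k+2)` the two layers
`x_{j k} · x_{j (k+1)} ∣`, and two layers never present an isolated `3`-fold point.  This file is the
verbatim generalisation to EVERY exponent `q ≥ 2` (idea-4's hand lemma BL2 with `|S| = 2`, CARD I-4-2,
and its triple bound (T), CARD I-4-3, in kernel form):

* §1 **two layers**: if every monomial of `P` is divisible by `x_a^{n_a} x_b^{n_b}` (`a ≠ b`) then
  `J_q⁺(P) ≤ (x_a, x_b, D^{(n_a e_a + n_b e_b)} P)` as soon as `n_a + n_b ≥ q − 1`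
  (`singLocusIdeal_le_span_triple_of_two_layers`; `≤ (x_a, x_b)` when `n_a + n_b ≥ q`), hence
  **`not_isIsolated_of_two_layers`** (three generators in `𝔪₀`: height `≤ 3 < 4`, p-9's
  `FreeTail.not_isIsolated_of_le_span_triple`); **three layers** with `n_a + n_b + n_c ≥ q` give
  `J_q⁺(P) ≤ (x_a, x_b, x_c)` and `not_isIsolated_of_three_layers` (idea-4's TRIPLE BOUND (T): at an isolated
  `q`-fold point every axis carries `r_a + r_b + r_c ≤ q − 1`).
* §2 layers along a witnessed chain: the hyperplane created by a step from a state of order `≥ m` enters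
  with layer `≥ m − q` (p-5's `IsolatedBand.apply_ge_of_mem_support_step`), a satellite step keeps it
  (p-9's `FreeTail.apply_ge_of_mem_support_step_of_ne`).
* §3 **SH(q)** `not_isIsolated_of_satellite_of_orders`: orders `≥ m₁, ≥ m₂` at `c k`, `c (k+1)` with
  `m₁ + m₂ ≥ 3q − 1` and step `k+1` satellite ⇒ `c (k+2)` is NOT an isolated `q`-fold point (at `q = 3`:
  `4 + 4 = 8 = 3·3 − 1`, SH3).
* §4 **THE UPPER BAND IS EMPTY OF TRAPS, every prime `p`**: `no_isolated_chain_of_orders` (FT(p,p) supplies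
  the satellite step) and **`noIsolatedUpperBandRun (p) [Fact p.Prime]`**: no infinite `Step0 p` chain of
  ISOLATED states all of order `≥ ⌈(3p − 1)/2⌉` — at `p = 3` this is K2(3) again (order `4`), at `p = 5`
  it empties the orders `{7, 8}` of the band `{6, 7, 8}`, at `p = 7` the orders `{10, 11, 12}`.  The LOWER
  band (`p < ord₀ < ⌈(3p−1)/2⌉`, idea-4's residual-order phases `2 ≤ d ≤ p − 1`, BCP′(p)) stays OPEN.
bears_on: LADDER-RESOLUTION:D157-DOOR2 (res-dim4-pi · F4-I(p,p) · K2(p) upper band).  Supports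
stmt-ResolutionOfSingularities-16155 (helper).
-/

set_option linter.dupNamespace false -- mandated namespace of this single-conjunct summit

noncomputable section

namespace Summit.ResolutionOfSingularities.ResolutionOfSingularities.Theorems.PIDim4

namespace BandLayers

open MvPolynomial Finset
open Literature.AlgebraicGeometry.Resolution
open Literature.AlgebraicGeometry.Resolution.CentreBlowup
open Literature.AlgebraicGeometry.Resolution.Hauser2010
open FreeTail (IsWitnessedChain IsSatellite)

variable {K : Type} [Field K]

/-! ## 1. Two layers (BL2, `|S| = 2`) and three layers (the triple bound) -/

/-- An exponent of degree `≤ n_a + n_b` with `α_a ≥ n_a`, `α_b ≥ n_b` (`a ≠ b`) is `n_a e_a + n_b e_b`.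
[folklore] -/
theorem eq_single_add_single_of_degree_le {a b : Fin 4} (hab : a ≠ b) {na nb : ℕ} {α : Fin 4 →₀ ℕ}
    (hα : α.degree ≤ na + nb) (ha : na ≤ α a) (hb : nb ≤ α b) :
    α = Finsupp.single a na + Finsupp.single b nb := by
  classical
  have hsum : α.degree = α a + (α b + ∑ i ∈ (Finset.univ.erase a).erase b, α i) := by
    rw [Finsupp.degree_eq_sum, ← Finset.add_sum_erase _ _ (Finset.mem_univ a),
      ← Finset.add_sum_erase _ _ (Finset.mem_erase.mpr ⟨hab.symm, Finset.mem_univ b⟩)]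
  have ha1 : α a = na := by omega
  have hb1 : α b = nb := by omega
  have hrest : ∑ i ∈ (Finset.univ.erase a).erase b, α i = 0 := by omega
  ext i
  rw [Finsupp.add_apply, Finsupp.single_apply, Finsupp.single_apply]
  by_cases hia : a = i
  · rw [if_pos hia, if_neg (fun h : b = i => hab (hia.trans h.symm))]
    subst hia
    omega
  · by_cases hib : b = i
    · rw [if_neg hia, if_pos hib]
      subst hib
      omega
    · rw [if_neg hia, if_neg hib]
      exact Finset.sum_eq_zero_iff.mp hrest i
        (Finset.mem_erase.mpr ⟨fun h => hib h.symm,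
          Finset.mem_erase.mpr ⟨fun h => hia h.symm, Finset.mem_univ i⟩⟩)

/-- **TWO-LAYER LEMMA, every `q`.**  If every monomial of `P` is divisible by `x_a^{n_a} x_b^{n_b}`
(`a ≠ b`) and `n_a + n_b ≥ q − 1`, then `J_q⁺(P) ≤ (x_a, x_b, D^{(n_a e_a + n_b e_b)} P)`: a Hasse derivative
`D^{(α)}`, `0 < |α| < q`, with `α_a < n_a` or `α_b < n_b` stays in `(x_a)` resp. `(x_b)`
(`IsolatedBand.hasseDeriv_mem_span_X_of_layer`), and otherwise `α = n_a e_a + n_b e_b`.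
(idea-4 CARD I-4-2, BL2 with `|S| = 2`; at `q = 3`, `n_a = n_b = 1`: p-9's
`FreeTail.singLocusIdeal_three_le_span_triple_of_two_layers`.) [folklore] -/
theorem singLocusIdeal_le_span_triple_of_two_layers (q : ℕ) {a b : Fin 4} (hab : a ≠ b) {na nb : ℕ}
    {P : MvPolynomial (Fin 4) K} (ha : ∀ e ∈ P.support, na ≤ e a) (hb : ∀ e ∈ P.support, nb ≤ e b)
    (hn : q ≤ na + nb + 1) :
    singLocusIdeal q P ≤ Ideal.span {(X a : MvPolynomial (Fin 4) K), X b,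
      hasseDeriv (Finsupp.single a na + Finsupp.single b nb) P} := by
  classical
  unfold singLocusIdeal
  rw [Ideal.span_le]
  rintro _ ⟨α, -, hαq, rfl⟩
  by_cases hαa : α a < na
  · have hmem := IsolatedBand.hasseDeriv_mem_span_X_of_layer ha hαa
    exact Ideal.span_mono (Set.singleton_subset_iff.mpr (Set.mem_insert _ _)) hmem
  · by_cases hαb : α b < nb
    · have hmem := IsolatedBand.hasseDeriv_mem_span_X_of_layer hb hαb
      exact Ideal.span_mono (Set.singleton_subset_iff.mpr
        (Set.mem_insert_of_mem _ (Set.mem_insert _ _))) hmem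
    · have hα := eq_single_add_single_of_degree_le hab (na := na) (nb := nb) (α := α)
        (by omega) (by omega) (by omega)
      subst hα
      exact Ideal.subset_span (Set.mem_insert_of_mem _ (Set.mem_insert_of_mem _ rfl))

/-- **Two thick layers**: if moreover `n_a + n_b ≥ q`, then `J_q⁺(P) ≤ (x_a, x_b)` (the third case cannot
occur below degree `q`). [folklore] -/
theorem singLocusIdeal_le_span_pair_of_two_layers (q : ℕ) {a b : Fin 4} (hab : a ≠ b) {na nb : ℕ}
    {P : MvPolynomial (Fin 4) K} (ha : ∀ e ∈ P.support, na ≤ e a) (hb : ∀ e ∈ P.support, nb ≤ e b)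
    (hn : q ≤ na + nb) :
    singLocusIdeal q P ≤ Ideal.span {(X a : MvPolynomial (Fin 4) K), X b} := by
  classical
  unfold singLocusIdeal
  rw [Ideal.span_le]
  rintro _ ⟨α, -, hαq, rfl⟩
  by_cases hαa : α a < na
  · have hmem := IsolatedBand.hasseDeriv_mem_span_X_of_layer ha hαa
    exact Ideal.span_mono (Set.singleton_subset_iff.mpr (Set.mem_insert _ _)) hmem
  · by_cases hαb : α b < nb
    · have hmem := IsolatedBand.hasseDeriv_mem_span_X_of_layer hb hαb
      exact Ideal.span_mono (Set.singleton_subset_iff.mpr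
        (Set.mem_insert_of_mem _ (Set.mem_singleton _))) hmem
    · exfalso
      have hsum : α a + α b ≤ α.degree := by
        rw [Finsupp.degree_eq_sum, ← Finset.add_sum_erase _ _ (Finset.mem_univ a),
          ← Finset.add_sum_erase _ _ (Finset.mem_erase.mpr ⟨hab.symm, Finset.mem_univ b⟩)]
        omega
      omega

/-- **NOT ISOLATED OFF TWO LAYERS, every `q ≥ 2`**: a polynomial all of whose monomials are divisible by
`x_a^{n_a} x_b^{n_b}` (`a ≠ b`, `n_a + n_b ≥ q − 1`) never presents an isolated `q`-fold point at the
origin (three generators in `𝔪₀` have a minimal prime of height `≤ 3 < 4 = ht 𝔪₀`, or the third generator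
is a unit-order element of `J_q⁺(P)` and `J_q⁺(P) ≰ 𝔪₀`). [folklore] -/
theorem not_isIsolated_of_two_layers {q : ℕ} (hq : 2 ≤ q) {a b : Fin 4} (hab : a ≠ b) {na nb : ℕ}
    {P : MvPolynomial (Fin 4) K} (ha : ∀ e ∈ P.support, na ≤ e a) (hb : ∀ e ∈ P.support, nb ≤ e b)
    (hn : q ≤ na + nb + 1) : ¬ IsIsolated q P := by
  classical
  by_cases hbig : q ≤ na + nb
  · exact IsolatedBand.not_isIsolated_of_le_span_pair
      (singLocusIdeal_le_span_pair_of_two_layers q hab ha hb hbig)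
      (IsolatedScope.X_mem_originIdeal a) (IsolatedScope.X_mem_originIdeal b)
  · have heq : na + nb + 1 = q := by omega
    have hJ := singLocusIdeal_le_span_triple_of_two_layers q hab ha hb hn
    set D := hasseDeriv (Finsupp.single a na + Finsupp.single b nb) P with hDdef
    by_cases hD : D ∈ originIdeal K
    · exact FreeTail.not_isIsolated_of_le_span_triple hJ (IsolatedScope.X_mem_originIdeal a)
        (IsolatedScope.X_mem_originIdeal b) hD
    · -- `D` is itself a generator of `J_q⁺(P)` (order `q − 1 ≥ 1`), so `J_q⁺(P) ≰ 𝔪₀`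
      rintro ⟨hle, -⟩
      apply hD
      refine hle (Ideal.subset_span ⟨Finsupp.single a na + Finsupp.single b nb, ?_, ?_, rfl⟩)
      · rw [map_add, Finsupp.degree_single, Finsupp.degree_single]
        omega
      · rw [map_add, Finsupp.degree_single, Finsupp.degree_single]
        omega

/-- **THREE LAYERS (idea-4's TRIPLE BOUND (T), CARD I-4-3)**: if every monomial of `P` is divisible by
`x_a^{n_a} x_b^{n_b} x_c^{n_c}` with `n_a + n_b + n_c ≥ q`, then `J_q⁺(P) ≤ (x_a, x_b, x_c)` — a Hasse
derivative of order `< q` cannot exhaust all three layers. [folklore] -/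
theorem singLocusIdeal_le_span_of_three_layers (q : ℕ) {a b c : Fin 4} {na nb nc : ℕ}
    {P : MvPolynomial (Fin 4) K} (ha : ∀ e ∈ P.support, na ≤ e a) (hb : ∀ e ∈ P.support, nb ≤ e b)
    (hc : ∀ e ∈ P.support, nc ≤ e c) (hab : a ≠ b) (hac : a ≠ c) (hbc : b ≠ c)
    (hn : q ≤ na + nb + nc) :
    singLocusIdeal q P ≤ Ideal.span {(X a : MvPolynomial (Fin 4) K), X b, X c} := by
  classical
  unfold singLocusIdeal
  rw [Ideal.span_le]
  rintro _ ⟨α, -, hαq, rfl⟩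
  by_cases hαa : α a < na
  · have hmem := IsolatedBand.hasseDeriv_mem_span_X_of_layer ha hαa
    exact Ideal.span_mono (Set.singleton_subset_iff.mpr (Set.mem_insert _ _)) hmem
  · by_cases hαb : α b < nb
    · have hmem := IsolatedBand.hasseDeriv_mem_span_X_of_layer hb hαb
      exact Ideal.span_mono (Set.singleton_subset_iff.mpr
        (Set.mem_insert_of_mem _ (Set.mem_insert _ _))) hmem
    · by_cases hαc : α c < nc
      · have hmem := IsolatedBand.hasseDeriv_mem_span_X_of_layer hc hαc
        exact Ideal.span_mono (Set.singleton_subset_iff.mpr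
          (Set.mem_insert_of_mem _ (Set.mem_insert_of_mem _ (Set.mem_singleton _)))) hmem
      · exfalso
        have hsum : α a + (α b + α c) ≤ α.degree := by
          rw [Finsupp.degree_eq_sum, ← Finset.add_sum_erase _ _ (Finset.mem_univ a),
            ← Finset.add_sum_erase _ _ (Finset.mem_erase.mpr ⟨hab.symm, Finset.mem_univ b⟩),
            ← Finset.add_sum_erase _ _ (Finset.mem_erase.mpr ⟨hbc.symm,
              Finset.mem_erase.mpr ⟨hac.symm, Finset.mem_univ c⟩⟩)]
          omega
        omega

/-- **Not isolated off three thick layers** (`n_a + n_b + n_c ≥ q`): three variables generate an ideal of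
height `≤ 3 < 4`.  Read on the boundary of an isolated `q`-fold point: every triple of exceptional
components through it has `r_a + r_b + r_c ≤ q − 1` (idea-4's (T)). [folklore] -/
theorem not_isIsolated_of_three_layers {q : ℕ} {a b c : Fin 4} {na nb nc : ℕ}
    {P : MvPolynomial (Fin 4) K} (ha : ∀ e ∈ P.support, na ≤ e a) (hb : ∀ e ∈ P.support, nb ≤ e b)
    (hc : ∀ e ∈ P.support, nc ≤ e c) (hab : a ≠ b) (hac : a ≠ c) (hbc : b ≠ c)
    (hn : q ≤ na + nb + nc) : ¬ IsIsolated q P :=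
  FreeTail.not_isIsolated_of_le_span_triple (singLocusIdeal_le_span_of_three_layers q ha hb hc hab hac hbc hn)
    (IsolatedScope.X_mem_originIdeal a) (IsolatedScope.X_mem_originIdeal b)
    (IsolatedScope.X_mem_originIdeal c)

/-! ## 2. Layers along a witnessed `Step0` chain -/

/-- **The new hyperplane's layer**: along a witnessed chain, if `c k` has order `≥ m`, every monomial of
`(c (k+1)).F` has `x_{j k}`-exponent `≥ m − q`. [folklore] -/
theorem le_apply_new [DecidableEq K] {q : ℕ} {c : ℕ → State K} {j : ℕ → Fin 4} {b : ℕ → Fin 4 → K}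
    (hw : IsWitnessedChain q c j b) (k : ℕ) {m : ℕ} (hm : (m : ℕ∞) ≤ ordZero (c k).F) :
    ∀ e ∈ (c (k + 1)).F.support, m - q ≤ e (j k) := by
  intro e he
  obtain ⟨-, hbj, -, -, hstep⟩ := hw k
  rw [hstep] at he
  have hm' : (m : ℕ∞) ≤ ordAlong Finset.univ (c k).F := by rwa [ordAlong_univ]
  exact IsolatedBand.apply_ge_of_mem_support_step hbj (c k) hm' he

/-- **A satellite step keeps the previous layer**: if step `k+1` is satellite w.r.t. the hyperplane created
at step `k`, the `x_{j k}`-layer of `c (k+1)` survives in `c (k+2)`. [folklore] -/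
theorem le_apply_kept [DecidableEq K] {q : ℕ} {c : ℕ → State K} {j : ℕ → Fin 4} {b : ℕ → Fin 4 → K}
    (hw : IsWitnessedChain q c j b) (k : ℕ) (hsat : IsSatellite j b k) {n : ℕ}
    (hn : ∀ e ∈ (c (k + 1)).F.support, n ≤ e (j k)) :
    ∀ e ∈ (c (k + 2)).F.support, n ≤ e (j k) := by
  intro e he
  obtain ⟨hne, hb0⟩ := hsat
  obtain ⟨-, -, -, -, hstep⟩ := hw (k + 1)
  rw [hstep] at he
  exact FreeTail.apply_ge_of_mem_support_step_of_ne hne.symm hb0 (c (k + 1)) hn he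

/-! ## 3. The shape lemma SH(q) -/

/-- **SHAPE LEMMA SH(q), every `q ≥ 2`** (I-7-2's (SH3) for all exponents).  Along a witnessed `Step0 q`
chain: if `c k` has order `≥ m₁`, `c (k+1)` has order `≥ m₂`, `m₁ + m₂ ≥ 3q − 1`, and step `k+1` is
SATELLITE w.r.t. the hyperplane created at step `k`, then `c (k+2)` is NOT an isolated `q`-fold point: its
residual polynomial carries the layers `x_{j k}^{m₁ − q} · x_{j (k+1)}^{m₂ − q}`, of total thickness
`≥ q − 1` (§1).  No characteristic, permissibility or isolation hypothesis is used. [folklore] -/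
theorem not_isIsolated_of_satellite_of_orders [DecidableEq K] {q : ℕ} (hq : 2 ≤ q) {c : ℕ → State K}
    {j : ℕ → Fin 4} {b : ℕ → Fin 4 → K} (hw : IsWitnessedChain q c j b) (k : ℕ) {m₁ m₂ : ℕ}
    (h1 : (m₁ : ℕ∞) ≤ ordZero (c k).F) (h2 : (m₂ : ℕ∞) ≤ ordZero (c (k + 1)).F)
    (hsum : 3 * q ≤ m₁ + m₂ + 1) (hsat : IsSatellite j b k) : ¬ IsIsolated q (c (k + 2)).F := by
  have hne : j (k + 1) ≠ j k := hsat.1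
  have ha : ∀ e ∈ (c (k + 2)).F.support, m₁ - q ≤ e (j k) :=
    le_apply_kept hw k hsat (le_apply_new hw k h1)
  have hb : ∀ e ∈ (c (k + 2)).F.support, m₂ - q ≤ e (j (k + 1)) := by
    have := le_apply_new hw (k + 1) h2
    simpa only [show k + 1 + 1 = k + 2 by ring] using this
  exact not_isIsolated_of_two_layers hq hne.symm ha hb (by omega)

/-! ## 4. The upper band is empty of traps, every prime -/

/-- **No isolated chain with consecutive orders summing to `≥ 3p − 1`**: FT(p,p)
(`FreeTailProof.noIsolatedFreeTailAt_self`, positive form) supplies a satellite step, and SH(p) a non-isolated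
state two steps later. [OURS · glue] [folklore] -/
theorem no_isolated_chain_of_orders (p : ℕ) [Fact p.Prime] [CharP K p] [DecidableEq K]
    {c : ℕ → State K} (hc : ∀ k, IsIsolated p (c k).F ∧ Step0 p (c k) (c (k + 1))) (m : ℕ → ℕ)
    (hm : ∀ k, (m k : ℕ∞) ≤ ordZero (c k).F) (hsum : ∀ k, 3 * p ≤ m k + m (k + 1) + 1) : False := by
  have hp : 2 ≤ p := (Fact.out : p.Prime).two_le
  obtain ⟨j, b, hw⟩ := FreeTail.exists_witnesses (K := K) (fun k => (hc k).2)
  have hFT := (FreeTail.satelliteRecurrenceAt_iff_noIsolatedFreeTailAt p p).mpr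
    (FreeTailProof.noIsolatedFreeTailAt_self p)
  obtain ⟨k, -, hsat⟩ := hFT K c j b hw (fun k => (hc k).1) 0
  exact not_isIsolated_of_satellite_of_orders hp hw k (hm k) (hm (k + 1)) (hsum k) hsat (hc (k + 2)).1

/-- **THE UPPER BAND IS EMPTY OF TRAPS**: for every prime `p` there is no infinite `Step0 p` chain of
ISOLATED `p`-fold states all of order `≥ ⌈(3p − 1)/2⌉` (`= (3p)/2` in natural-number division).  At `p = 3`
this is K2(3) (`ord₀ ≡ 4`); at `p = 5` the orders `{7, 8}` of the band `{6, 7, 8}`; the lower band stays open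
(idea-4's BCP′(p)).  [OURS] [folklore] -/
theorem noIsolatedUpperBandRun (p : ℕ) [Fact p.Prime] :
    ∀ (K : Type) [Field K] [CharP K p] [DecidableEq K],
      ¬ ∃ c : ℕ → State K, ∀ k, IsIsolated p (c k).F ∧ Step0 p (c k) (c (k + 1)) ∧
        (((3 * p) / 2 : ℕ) : ℕ∞) ≤ ordZero (c k).F := by
  intro K _ _ _
  rintro ⟨c, hc⟩
  refine no_isolated_chain_of_orders p (fun k => ⟨(hc k).1, (hc k).2.1⟩) (fun _ => (3 * p) / 2)
    (fun k => (hc k).2.2) fun _ => ?_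
  omega

/-- The same with a THRESHOLD FROM SOME INDEX ON (a tail of an isolated chain is an isolated chain).
[OURS] [folklore] -/
theorem no_isolated_chain_eventually_upper (p : ℕ) [Fact p.Prime] [CharP K p] [DecidableEq K]
    {c : ℕ → State K} (hc : ∀ k, IsIsolated p (c k).F ∧ Step0 p (c k) (c (k + 1))) {k₀ : ℕ}
    (hup : ∀ k, k₀ ≤ k → (((3 * p) / 2 : ℕ) : ℕ∞) ≤ ordZero (c k).F) : False :=
  noIsolatedUpperBandRun p K ⟨fun k => c (k₀ + k), fun k =>
    ⟨(hc (k₀ + k)).1, by simpa only [Nat.add_succ] using (hc (k₀ + k)).2,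
      hup (k₀ + k) (Nat.le_add_right _ _)⟩⟩

end BandLayers

end Summit.ResolutionOfSingularities.ResolutionOfSingularities.Theorems.PIDim4

end
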